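import Summits.QuantumFields.QCD.Theorems.RobustYangMills.Negative.MixtureWitness
import Summits.QuantumFields.QCD.Theorems.SeaFactorisationBridge.Negative.RobustYangMillsContainsYM

/-!
# `RobustYangMills` — the tree's reduction `yangMillsSU3_of_robustYangMills` made unconditional

The tree file `SeaFactorisationBridge/Negative/RobustYangMillsContainsYM.lean` proves
`RobustYangMills → (body of the summit conjunct YangMills at SU(3))` modulo the hypothesis `hRP`:
reflection positivity, in D1's format, of `W ≡ 0` on every odd torus `(ℤ/(2S+1))⁴`. That hypothesis
is a theorem (`Negative/MixtureWitness.lean`: `isReflectionPositive_zero_all`, from the tree's PROVED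
`wilsonExpectation_oddReflectionPositive`, plus the one-site torus `S = 0` where positive-time
observables are constants). Item stmt-QuantumFields-13897 (cdisprove cycle 1).

(buildfix 2026-08-19, no declaration changed: `Summit.QuantumFields.QCD.Theses.NestedDissectionSea.RobustYangMills`,
dropped from the route file `NestedDissectionSea` at rev 25, is the record re-declared verbatim in
`Theorems/RobustYangMills/Negative/NoSmallFalse.lean`, visible here through the import chain
`RobustYangMillsContainsYM → NoSmallFalse` since p201268.)
-/

noncomputable section

open Literature.MathematicalPhysics.QuantumLattice Literature.MathematicalPhysics.AQFT
  Literature.MathematicalPhysics.QuantumFieldTheory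

namespace Summit.QuantumFields.QCD.Theorems.RobustYangMills.Negative

/-- **`RobustYangMills` ⊇ the body of the summit conjunct `YangMills` at `G = SU(3)`,
UNCONDITIONALLY**: the tree's `SeaFactorisationBridge.Negative.yangMillsSU3_of_robustYangMills`
with its odd-torus reflection-positivity hypothesis discharged by `isReflectionPositive_zero_all`.
[folklore] -/
theorem yangMillsSU3_of_robustYangMills'
    (hY : Summit.QuantumFields.QCD.Theses.NestedDissectionSea.RobustYangMills) :
    let r₃ : LatticeRep (Matrix.specialUnitaryGroup (Fin 3) ℂ) := ⟨3, fundamentalRep (Fin 3),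
      continuous_fundamentalRep _, fundamentalRep_injective _, fundamentalRep_mem_unitaryGroup⟩
    ∃ (sch : SpeciesScheme (YMSpecies (Matrix.specialUnitaryGroup (Fin 3) ℂ)))
      (T : OSData (YMSpecies (Matrix.specialUnitaryGroup (Fin 3) ℂ)) 4),
      IsYangMillsFor r₃ sch T ∧ T.IsNontrivial r₃.curvature ∧ T.IsNonGaussian r₃.curvature ∧
        ∃ Δ > 0, T.HasMassGap Δ ∧ HasLatticeMassGap r₃ sch Δ :=
  Summit.QuantumFields.QCD.Theorems.SeaFactorisationBridge.Negative.yangMillsSU3_of_robustYangMills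
    (fun S b _β hβ => isReflectionPositive_zero_all (fundamentalRep (Fin 3))
      (continuous_fundamentalRep _) S b hβ) hY


end Summit.QuantumFields.QCD.Theorems.RobustYangMills.Negative

end
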